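import Literature.Computability.QuantumComplexity.UniversalExecutor
import Literature.Computability.QuantumComplexity.UnaryCircuitDescription
import Literature.Computability.Complexity.CodeFPFinite
import Literature.Computability.Complexity.CodeFPLists
import Literature.Computability.Complexity.CodeFPStrings
import HarnessLib

/-!
# Inputs for the universal executor: gate tables in polynomial time, and a random register by purification

Topic `Literature/Computability/QuantumComplexity`; sequel of `UniversalExecutor.lean` (the uniform
Clifford+`T` family `UExec.family` executing the circuit written as a one-hot gate table on its input
wires; `UExec.acceptProbOn_family`, `UExec.family_isUniform`) and second step of the discharge of the
named fact `knillLaflamme1998_DQC1_subset_BQP` (`OneCleanQubit.lean`; assembled in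
`OneCleanQubitProofs.lean`). This file supplies the INPUT side (`namespace UExec`):

* **Gate tables.** `rowOf t raws s` (the bits `[raws[s] = γ]` for the candidate raw gates `γ` in
  column order), `tableOfL ℓ raws` (leading `0`, the `tOf ℓ` rows, `0`-padding to length `ℓ`);
  `length_tableOfL`, `getD_tableOfL_cw`, `getD_rowOf_col`, and **`getD_tableOfL_iff`**: for a gate list
  `gs` on `tOf ℓ` wires the table of `gs.map toRaw` has the bit of slot `s`, candidate `δ` set iff
  `gs[s] = δ.toGate` (injectivity of the raw code, `toRaw_injective` of `UnaryCircuitDescription.lean`), whence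
  **`acceptProbOn_family_tableOfL`**: on that table the executor accepts with the probability that
  `gs`, run on `|0…0⟩`, yields `1` on wire `0`.
* **The table in polynomial time.** `tableOfL_fp : CodeFP (⟨1^ℓ, raws⟩) ↦ tableOfL ℓ raws` in the
  typed `FP` algebra (`Complexity/CodeFP*.lean`: ranges, maps with context, `drop`/`head?` for
  `raws[s]?`, option codes and their comparison, `replicate`, bits-to-string), Arora–Barak §1.3.
* **Idle wires** (`probEvent_mapWires_castLE`, `rawGates_mapWires_castLE`): transporting a circuit to
  the first wires of a wider register changes neither the wire-`0` statistics on `|0…0⟩` nor the raw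
  description.
* **A random register by purification** (Nielsen–Chuang §2.5; Knill–Laflamme's DQC1 input "one bit in
  a pure state and the rest completely random"): `purified k C` puts a Bell pair (`bellCirc`: `H` on
  the partner, `CNOT` partner → register; §1.3.6) between each register wire `1 + i` and a fresh partner
  wire `1 + k + i` and then runs `C` on the wires `0 … k`; `bellLayer_mulVec_zero` (the Bell layer
  prepares `2^{-k/2} ∑_r |0, r, r⟩`, by the frame rule for product states of `CircuitEmbedding.lean`),
  and **`probEvent_purified`**: the purified circuit yields `1` on wire `0` with probability
  `2^{-k} ∑_r Pr[C run on |0⟩|r⟩ yields 1 on wire 0]` (block states with classical rest,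
  `RestBlockStates.lean`); `rawGates_purified`.
* **The DQC1 front end.** `dqcTableRaw k raws` = the table of length `t⁴`, `t = 3 + 2k + |raws|`, of
  the purified circuit; **`acceptProbOn_family_dqcTableRaw`** (the executor on it computes the DQC1
  average) and **`dqcTableRaw_fp`** (computed in polynomial time from `⟨1ᵏ, raws⟩`).

No named facts are introduced; everything is proved.

## References

* M. A. Nielsen, I. L. Chuang, *Quantum Computation and Quantum Information*, CUP 2010, §1.3.6
  (Bell states), §2.2.8, §2.5 (purifications), §4.5 (circuit model) [NielsenChuang2010].
* E. Knill, R. Laflamme, *Power of one bit of quantum information*, Phys. Rev. Lett. 81 (1998)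
  5672–5675, p. 5673 (DQC1) [KnillLaflamme1998].
* S. Arora, B. Barak, *Computational Complexity: A Modern Approach*, CUP 2009, §1.3, §6.2
  [AroraBarak2009].
-/

noncomputable section

namespace Literature.Computability.QuantumComplexity

open _root_.Computability Complexity Cryptography Matrix

namespace UExec

/-! ### The gate table of a raw gate list -/

/-- Row `s` of the gate table for register width `t`: the bits `[raws[s] = γ]` for the candidate raw
gates `γ` in column order (`H i`, `S i`, `T i`, then `CNOT i j` row-major, diagonal never set).
[folklore] -/
def rowOf (t : ℕ) (raws : List RawGate) (s : ℕ) : List Bool :=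
  (List.range t).map (fun i => decide (raws[s]? = some (false, 0, [i]))) ++
    ((List.range t).map (fun i => decide (raws[s]? = some (false, 1, [i]))) ++
      ((List.range t).map (fun i => decide (raws[s]? = some (false, 2, [i]))) ++
        (List.range t).flatMap fun i => (List.range t).map fun j => decide (raws[s]? = some (false, 3, [i, j]))))

/-- **The gate table of length `ℓ`** of a raw gate list: a leading `0` (the clean measured wire),
the `tOf ℓ` rows, and `0`-padding up to length `ℓ` (exact under `Fits ℓ`). [folklore] -/
def tableOfL (ℓ : ℕ) (raws : List RawGate) : List Bool :=
  false :: ((List.range (tOf ℓ)).flatMap (rowOf (tOf ℓ) raws) ++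
    List.replicate (ℓ - (1 + tOf ℓ * rowW (tOf ℓ))) false)

/-- A `flatMap` of blocks of equal length `L` has length `n L`. [folklore] -/
theorem length_flatMap_range_const {α : Type*} {L n : ℕ} (f : ℕ → List α) (hf : ∀ i, (f i).length = L) :
    ((List.range n).flatMap f).length = n * L := by
  induction n with
  | zero => simp
  | succ n ih => rw [List.range_succ, List.flatMap_append, List.length_append, ih]; simp [hf]; ring

/-- Indexing a `flatMap` of blocks of equal length `L`: position `s L + c` is position `c` of block
`s`. [folklore] -/
theorem getD_flatMap_range_const {α : Type*} {L n : ℕ} (f : ℕ → List α) (hf : ∀ i, (f i).length = L)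
    {s c : ℕ} (hs : s < n) (hc : c < L) (d : α) :
    ((List.range n).flatMap f).getD (s * L + c) d = (f s).getD c d := by
  induction n with
  | zero => exact absurd hs (Nat.not_lt_zero _)
  | succ n ih =>
    rw [List.range_succ, List.flatMap_append, List.flatMap_singleton]
    by_cases hsn : s < n
    · rw [List.getD_append _ _ _ _ (by rw [length_flatMap_range_const f hf]; nlinarith), ih hsn]
    · obtain rfl : s = n := by omega
      rw [List.getD_append_right _ _ _ _ (by rw [length_flatMap_range_const f hf]; omega),
        length_flatMap_range_const f hf, Nat.add_sub_cancel_left]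

/-- Rows have length `rowW t`. [folklore] -/
theorem length_rowOf (t : ℕ) (raws : List RawGate) (s : ℕ) : (rowOf t raws s).length = rowW t := by
  rw [rowOf, List.length_append, List.length_append, List.length_append, List.length_map, List.length_map,
    List.length_map, List.length_range, length_flatMap_range_const (L := t) _ (fun i => by simp), rowW]
  ring

/-- The arithmetic of `Fits`: `1 + t · rowW t ≤ t⁴` once `t ≥ 3`. [folklore] -/
theorem one_add_mul_rowW_le_pow_four {t : ℕ} (ht : 3 ≤ t) : 1 + t * rowW t ≤ t ^ 4 := by
  unfold rowW
  have h1 : t + 6 ≤ t * t := le_trans (by omega : t + 6 ≤ 3 * t) (Nat.mul_le_mul_right t ht)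
  have h2 : t * t * (t + 6) ≤ t * t * (t * t) := Nat.mul_le_mul_left _ h1
  have h3 : 1 ≤ t * t := le_trans (by norm_num) (Nat.mul_le_mul ht ht)
  calc 1 + t * (3 * t + t * t) ≤ 3 * (t * t) + (3 * (t * t) + t * (t * t)) := by nlinarith
    _ = t * t * (t + 6) := by ring
    _ ≤ t * t * (t * t) := h2
    _ = t ^ 4 := by ring

/-- **The table has length `ℓ`** (under `Fits ℓ`). [folklore] -/
theorem length_tableOfL {ℓ : ℕ} (hF : Fits ℓ) (raws : List RawGate) : (tableOfL ℓ raws).length = ℓ := by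
  unfold Fits at hF
  rw [tableOfL, List.length_cons, List.length_append, List.length_replicate,
    length_flatMap_range_const _ (length_rowOf _ raws)]
  omega

/-- The leading bit of the table is `0`. [folklore] -/
theorem getD_tableOfL_zero (ℓ : ℕ) (raws : List RawGate) : (tableOfL ℓ raws).getD 0 false = false := rfl

/-- The table bit at `cw ℓ s c` is bit `c` of row `s`. [folklore] -/
theorem getD_tableOfL_cw {ℓ s c : ℕ} (hs : s < tOf ℓ) (hc : c < rowW (tOf ℓ)) (raws : List RawGate) :
    (tableOfL ℓ raws).getD (cw ℓ s c) false = (rowOf (tOf ℓ) raws s).getD c false := by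
  rw [tableOfL, cw, show 1 + s * rowW (tOf ℓ) + c = (s * rowW (tOf ℓ) + c) + 1 by ring, List.getD_cons_succ,
    List.getD_append _ _ _ _ ?_, getD_flatMap_range_const _ (length_rowOf _ raws) hs hc]
  rw [length_flatMap_range_const _ (length_rowOf _ raws)]
  calc s * rowW (tOf ℓ) + c < s * rowW (tOf ℓ) + rowW (tOf ℓ) := by omega
    _ = (s + 1) * rowW (tOf ℓ) := by ring
    _ ≤ tOf ℓ * rowW (tOf ℓ) := Nat.mul_le_mul_right _ hs

/-- The bits of a row: reading the column of a candidate gives the comparison of `raws[s]` with the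
raw gate of the candidate. [folklore] -/
theorem getD_rowOf_col {t : ℕ} (raws : List RawGate) (s : ℕ) (δ : Cand t) :
    (rowOf t raws s).getD δ.col false = decide (raws[s]? = some δ.toGate.toRaw) := by
  have hL : ∀ (o : ℕ), ((List.range t).map fun i => decide (raws[s]? = some (false, o, [i]))).length = t := fun o => by simp
  cases δ with
  | H i =>
    show (rowOf t raws s).getD i false = decide (raws[s]? = some (false, 0, [(i : ℕ)]))
    rw [rowOf, List.getD_append _ _ _ _ (by rw [hL]; exact i.isLt), List.getD_eq_getElem _ _ (by rw [hL]; exact i.isLt)]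
    simp
  | S i =>
    show (rowOf t raws s).getD (t + i) false = decide (raws[s]? = some (false, 1, [(i : ℕ)]))
    rw [rowOf, List.getD_append_right _ _ _ _ (by rw [hL]; omega), hL, Nat.add_sub_cancel_left,
      List.getD_append _ _ _ _ (by rw [hL]; exact i.isLt), List.getD_eq_getElem _ _ (by rw [hL]; exact i.isLt)]
    simp
  | T i =>
    show (rowOf t raws s).getD (2 * t + i) false = decide (raws[s]? = some (false, 2, [(i : ℕ)]))
    rw [rowOf, List.getD_append_right _ _ _ _ (by rw [hL]; omega), hL, List.getD_append_right _ _ _ _ (by rw [hL]; omega),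
      hL, show 2 * t + i - t - t = i by omega,
      List.getD_append _ _ _ _ (by rw [hL]; exact i.isLt), List.getD_eq_getElem _ _ (by rw [hL]; exact i.isLt)]
    simp
  | C i j h =>
    show (rowOf t raws s).getD (3 * t + i * t + j) false = decide (raws[s]? = some (false, 3, [(i : ℕ), (j : ℕ)]))
    have hL' : ∀ i : ℕ, ((List.range t).map fun j => decide (raws[s]? = some (false, 3, [i, j]))).length = t := fun i => by simp
    rw [rowOf, List.getD_append_right _ _ _ _ (by rw [hL]; omega), hL, List.getD_append_right _ _ _ _ (by rw [hL]; omega),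
      hL, List.getD_append_right _ _ _ _ (by rw [hL]; omega), hL, show 3 * t + i * t + j - t - t - t = i * t + j by omega,
      getD_flatMap_range_const _ hL' i.isLt j.isLt, List.getD_eq_getElem _ _ (by rw [hL']; exact j.isLt)]
    simp

/-- **The table of a gate list describes it**: for `gs` on `tOf ℓ` wires, the bit of slot `s`,
candidate `δ` of `tableOfL ℓ (gs.map toRaw)` is set iff `gs[s] = δ.toGate` (the hypothesis `hrows` of
`acceptProbOn_family`). [folklore] -/
theorem getD_tableOfL_iff {ℓ : ℕ} (gs : List (QGate cliffordT (tOf ℓ))) (s : Fin (tOf ℓ)) (δ : Cand (tOf ℓ)) :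
    (tableOfL ℓ (gs.map QGate.toRaw)).getD (cw ℓ s δ.col) false = true ↔ gs[(s : ℕ)]? = some δ.toGate := by
  rw [getD_tableOfL_cw s.isLt δ.col_lt, getD_rowOf_col, decide_eq_true_iff, List.getElem?_map]
  cases gs[(s : ℕ)]? with
  | none => simp
  | some γ =>
    simp only [Option.map_some, Option.some.injEq]
    exact ⟨fun h => toRaw_injective (G := cliffordT) h, fun h => by rw [h]⟩

/-- **The executor on the table of a gate list.** For `Fits ℓ`, `tOf ℓ ≥ 1` and an oracle-free gate
list `gs` on `tOf ℓ` wires with `|gs| ≤ tOf ℓ`, the executor family accepts the table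
`tableOfL ℓ (gs.map toRaw)` with exactly the probability that `gs`, run on `|0…0⟩`, yields `1` on
wire `0`. [cite: NielsenChuang2010, §4.5 (the quantum circuit model)] -/
theorem acceptProbOn_family_tableOfL {ℓ : ℕ} (hF : Fits ℓ) (ht : 0 < tOf ℓ) (gs : List (QGate cliffordT (tOf ℓ)))
    (hlen : gs.length ≤ tOf ℓ) (hfree : ∀ γ ∈ gs, γ.IsOracleFree) :
    family.acceptProbOn 0 (tableOfL ℓ (gs.map QGate.toRaw)) =
      (⟨gs⟩ : QCircuit cliffordT (tOf ℓ)).probEvent 0 (basisState fun _ => false) (QCircuit.acceptEvent (tOf ℓ)) := by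
  -- transport along `T.length = ℓ`
  suffices key : ∀ (T : List Bool), T.length = ℓ → (∀ (s : Fin (tOf ℓ)) (δ : Cand (tOf ℓ)),
      T.getD (cw ℓ s δ.col) false = true ↔ gs[(s : ℕ)]? = some δ.toGate) → T.getD 0 false = false →
      family.acceptProbOn 0 T =
        (⟨gs⟩ : QCircuit cliffordT (tOf ℓ)).probEvent 0 (basisState fun _ => false) (QCircuit.acceptEvent (tOf ℓ)) from
    key _ (length_tableOfL hF _) (getD_tableOfL_iff gs) (getD_tableOfL_zero ℓ _)
  rintro T rfl hrows h0
  exact acceptProbOn_family T hF ht gs hlen hfree hrows h0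

/-! ### The gate table in polynomial time -/

section TableProgram

open Complexity.CodeFP

/-- The code of a raw gate is injective. [folklore] -/
theorem rawGateE_injective : Function.Injective RawGate.E := by
  rintro ⟨b, c, ws⟩ ⟨b', c', ws'⟩ h
  simp only [RawGate.E, List.cons.injEq] at h
  obtain ⟨rfl, h⟩ := h
  have := pairE_injective natE_injective (listE_injective natE_injective) h
  simp only [Prod.mk.injEq] at this
  obtain ⟨rfl, rfl⟩ := this
  rfl

/-- The context `(ℓ, raws)` of the table writer: unary table length, raw gate list. [folklore] -/
abbrev tcE : ℕ × List RawGate → List Bool := pairE unE (rawE RawGate.E)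

/-- `tOf ℓ ≤ ℓ`. [folklore] -/
theorem tOf_le (ℓ : ℕ) : tOf ℓ ≤ ℓ := le_trans (Nat.sqrt_le_self _) (Nat.sqrt_le_self _)

/-- One comparison bit of a row on codes: `decide (raws[min s ℓ]? = some (false, o, ws))` for a
computed wire list `ws`. [folklore] -/
theorem rowBit_of {σ : Type} {eσ : σ → List Bool} {L S : σ → ℕ} {Rw : σ → List RawGate} (o : ℕ) {ws : σ → List ℕ}
    (hL : CodeFP eσ unE L) (hS : CodeFP eσ natE S) (hR : CodeFP eσ (rawE RawGate.E) Rw) (hws : CodeFP eσ (listE natE) ws) :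
    CodeFP eσ bitE (fun c => decide ((Rw c)[min (S c) (L c)]? = some ((false, o, ws c) : RawGate))) := by
  have hmin : CodeFP eσ unE (fun c => min (S c) (L c)) := (unOfNatMin.comp (hL.pair hS) :)
  have hget : CodeFP eσ (optE RawGate.E) (fun c => (Rw c)[min (S c) (L c)]?) :=
    ((rawHead? RawGate.E).comp ((rawDropUn RawGate.E).comp (hmin.pair hR))).congr fun c => List.head?_drop
  have hsome : CodeFP eσ (optE RawGate.E) (fun c => some ((false, o, ws c) : RawGate)) :=
    ((optSome RawGate.E).comp (rawGate_of (const eσ o) hws) :)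
  exact ((eq (optE_injective rawGateE_injective)).comp (hget.pair hsome) :)

/-- The rows on codes (context `(ℓ, raws)`, item `s`), with the capped slot index. [folklore] -/
theorem rowOf_fp : CodeFP (pairE tcE natE) (rawE bitE)
    (fun p => rowOf (tOf p.1.1) p.1.2 (min p.2 p.1.1)) := by
  -- contexts `((ℓ, raws), s)` and `(((ℓ, raws), s), i)`
  have hL3 : CodeFP (pairE (pairE tcE natE) natE) unE (fun c => c.1.1.1) := (fst _ _).fst'.fst'
  have hR3 : CodeFP (pairE (pairE tcE natE) natE) (rawE RawGate.E) (fun c => c.1.1.2) := (fst _ _).fst'.snd'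
  have hS3 : CodeFP (pairE (pairE tcE natE) natE) natE (fun c => c.1.2) := (fst _ _).snd'
  have hI3 : CodeFP (pairE (pairE tcE natE) natE) natE (fun c => c.2) := snd _ _
  have hL4 : CodeFP (pairE (pairE (pairE tcE natE) natE) natE) unE (fun c => c.1.1.1.1) := (fst _ _).fst'.fst'.fst'
  have hR4 : CodeFP (pairE (pairE (pairE tcE natE) natE) natE) (rawE RawGate.E) (fun c => c.1.1.1.2) := (fst _ _).fst'.fst'.snd'
  have hS4 : CodeFP (pairE (pairE (pairE tcE natE) natE) natE) natE (fun c => c.1.1.2) := (fst _ _).fst'.snd'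
  have hI4 : CodeFP (pairE (pairE (pairE tcE natE) natE) natE) natE (fun c => c.1.2) := (fst _ _).snd'
  have hJ4 : CodeFP (pairE (pairE (pairE tcE natE) natE) natE) natE (fun c => c.2) := snd _ _
  have ht2 : CodeFP (pairE tcE natE) unE (fun c => tOf c.1.1) := tun_of (fst _ _).fst'
  have ht3 : CodeFP (pairE (pairE tcE natE) natE) unE (fun c => tOf c.1.1.1) := tun_of hL3
  have hb : ∀ o : ℕ, CodeFP (pairE tcE natE) (rawE bitE) (fun c => (List.range (tOf c.1.1)).map fun i =>
      decide (c.1.2[min c.2 c.1.1]? = some ((false, o, [i]) : RawGate))) := fun o =>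
    ((map (rowBit_of o hL3 hS3 hR3 (natListE1 hI3))).comp ((CodeFP.id _).pair (urange.comp ht2)) :)
  have hcj : CodeFP (pairE (pairE tcE natE) natE) (rawE bitE) (fun c => (List.range (tOf c.1.1.1)).map fun j =>
      decide (c.1.1.2[min c.1.2 c.1.1.1]? = some ((false, 3, [c.2, j]) : RawGate))) :=
    ((map (rowBit_of 3 hL4 hS4 hR4 (natListE2 hI4 hJ4))).comp ((CodeFP.id _).pair (urange.comp ht3)) :)
  have hc : CodeFP (pairE tcE natE) (rawE bitE) (fun c => (List.range (tOf c.1.1)).flatMap fun i =>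
      (List.range (tOf c.1.1)).map fun j => decide (c.1.2[min c.2 c.1.1]? = some ((false, 3, [i, j]) : RawGate))) :=
    flatMapRange (eσ := pairE tcE natE) (F := fun (c : (ℕ × List RawGate) × ℕ) (i : ℕ) =>
      (List.range (tOf c.1.1)).map fun j => decide (c.1.2[min c.2 c.1.1]? = some ((false, 3, [i, j]) : RawGate))) ht2 hcj
  have h : CodeFP (pairE tcE natE) (rawE bitE) (fun c =>
      ((List.range (tOf c.1.1)).map fun i => decide (c.1.2[min c.2 c.1.1]? = some ((false, 0, [i]) : RawGate))) ++
      (((List.range (tOf c.1.1)).map fun i => decide (c.1.2[min c.2 c.1.1]? = some ((false, 1, [i]) : RawGate))) ++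
      (((List.range (tOf c.1.1)).map fun i => decide (c.1.2[min c.2 c.1.1]? = some ((false, 2, [i]) : RawGate))) ++
      ((List.range (tOf c.1.1)).flatMap fun i => (List.range (tOf c.1.1)).map fun j =>
        decide (c.1.2[min c.2 c.1.1]? = some ((false, 3, [i, j]) : RawGate)))))) :=
    ((rawAppend _).comp ((hb 0).pair ((rawAppend _).comp ((hb 1).pair ((rawAppend _).comp ((hb 2).pair hc))))) :)
  exact h.congr fun c => (rfl : _ = rowOf (tOf c.1.1) c.1.2 (min c.2 c.1.1))

/-- **The gate table on codes**: `(1^ℓ, raws) ↦ tableOfL ℓ raws` is computed in polynomial time.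
[cite: AroraBarak2009, §1.3 (polynomial-time closure), §6.2] -/
theorem tableOfL_fp : CodeFP tcE strE (fun c => tableOfL c.1 c.2) := by
  have ht : CodeFP tcE unE (fun c => tOf c.1) := tun_of (fst _ _)
  have hrows0 : CodeFP tcE (rawE bitE) (fun c => (List.range (tOf c.1)).flatMap fun s => rowOf (tOf c.1) c.2 (min s c.1)) :=
    flatMapRange (eσ := tcE) (F := fun (c : ℕ × List RawGate) (s : ℕ) => rowOf (tOf c.1) c.2 (min s c.1)) ht rowOf_fp
  have hrows : CodeFP tcE (rawE bitE) (fun c => (List.range (tOf c.1)).flatMap (rowOf (tOf c.1) c.2)) :=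
    hrows0.congr fun c => List.flatMap_congr fun s hs => by
      rw [min_eq_left (le_trans (List.mem_range.1 hs).le (tOf_le _))]
  have hpadN : CodeFP tcE unE (fun c => c.1 - (1 + tOf c.1 * rowW (tOf c.1))) :=
    ((unOfNatMin.comp ((fst _ _).pair (natSub.comp ((natOfUn.comp (fst _ _)).pair (natAdd.comp ((const _ 1).pair
      (natMul.comp ((tnat_of (fst _ _)).pair (rowW_of (tnat_of (fst _ _))))))))))).congr fun c => by
        show min _ _ = _
        exact min_eq_left (Nat.sub_le _ _) :)
  have hpad : CodeFP tcE (rawE bitE) (fun c => List.replicate (c.1 - (1 + tOf c.1 * rowW (tOf c.1))) false) :=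
    ((replicateOf bitE).comp ((const _ false).pair hpadN) :)
  have h : CodeFP tcE (rawE bitE) (fun c => false :: ((List.range (tOf c.1)).flatMap (rowOf (tOf c.1) c.2) ++
      List.replicate (c.1 - (1 + tOf c.1 * rowW (tOf c.1))) false)) :=
    ((rawCons bitE).comp ((const _ false).pair ((rawAppend bitE).comp (hrows.pair hpad))) :)
  exact ((bitsToStr.comp h).congr fun c => rfl :)

end TableProgram

/-! ### Idle wires and raw descriptions under initial-segment transport -/

section CastLE

variable {a b : ℕ}

/-- **Idle wires do not change the acceptance statistics**: a circuit on the first `a` of `b`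
wires, all wires initialised to `0`, yields `1` on wire `0` with the probability of the `a`-wire
circuit. [cite: NielsenChuang2010, §2.2.8 (measurement of one register of a product state)] -/
theorem probEvent_mapWires_castLE (hab : a ≤ b) (ha : 0 < a) (A : Language Bool) (C : QCircuit cliffordT a) :
    (mapWires (Fin.castLEEmb hab) C).probEvent A (basisState fun _ => false) (QCircuit.acceptEvent b) =
      C.probEvent A (basisState fun _ => false) (QCircuit.acceptEvent a) := by
  classical
  have hev : ∀ y : QReg b, y ∈ QCircuit.acceptEvent b ↔ (y ∘ Fin.castLEEmb hab) ⟨0, ha⟩ = true := fun y =>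
    ⟨fun ⟨_, h⟩ => h, fun h => ⟨by omega, h⟩⟩
  have hev' : ∀ u : QReg a, u ∈ QCircuit.acceptEvent a ↔ u ⟨0, ha⟩ = true := fun u => ⟨fun ⟨_, h⟩ => h, fun h => ⟨ha, h⟩⟩
  rw [QCircuit.probEvent, QCircuit.probEvent, Finset.sum_filter, Finset.sum_filter, QCircuit.runOn, QCircuit.runOn,
    toMatrix_mapWires]
  simp_rw [hev, hev']
  rw [sum_normSq_placeGate_castLE hab (C.toMatrix A) (fun _ => false) (fun u => u ⟨0, ha⟩ = true)]
  refine Finset.sum_congr rfl fun u _ => ?_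
  rw [mulVec_basisState]
  rfl

/-- Transport along an initial-segment embedding does not change wire numerals. [folklore] -/
theorem toRaw_mapWiresGate_castLE (hab : a ≤ b) (γ : QGate cliffordT a) :
    (mapWiresGate (Fin.castLEEmb hab) γ).toRaw = γ.toRaw := by
  cases γ <;> rfl

/-- The raw gate list is unchanged by initial-segment transport. [folklore] -/
theorem rawGates_mapWires_castLE (hab : a ≤ b) (C : QCircuit cliffordT a) :
    (mapWires (Fin.castLEEmb hab) C).rawGates = C.rawGates := by
  rw [QCircuit.rawGates, QCircuit.rawGates, gates_mapWires, List.map_map]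
  exact List.map_congr_left fun γ _ => toRaw_mapWiresGate_castLE hab γ

end CastLE

/-! ### A maximally mixed register by purification (Bell pairs) -/

section Purify

variable (k : ℕ)

/-- Register wire `i` of the one-clean-qubit register `0, 1, …, k` (wire `1 + i`). [folklore] -/
def qW (i : Fin k) : Fin (1 + k + k) := ⟨1 + i, by omega⟩

/-- The partner (purifying) wire of register wire `i` (wire `1 + k + i`). [folklore] -/
def pW (i : Fin k) : Fin (1 + k + k) := ⟨1 + k + i, by omega⟩

/-- Values of the register wires. [folklore] -/
@[simp] theorem val_qW (i : Fin k) : (qW k i : ℕ) = 1 + i := rfl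

/-- Values of the partner wires. [folklore] -/
@[simp] theorem val_pW (i : Fin k) : (pW k i : ℕ) = 1 + k + i := rfl

/-- A register wire is not a partner wire. [folklore] -/
theorem qW_ne_pW (i j : Fin k) : qW k i ≠ pW k j := by
  intro h; have := congrArg Fin.val h; simp at this; omega

/-- The Bell block of register wire `i`: local wire `0` = the register wire, local wire `1` = its
partner. [folklore] -/
def bellE (i : Fin k) : Fin 2 ↪ Fin (1 + k + k) := pairEmb (qW k i) (pW k i) (qW_ne_pW k i i)

/-- The Bell-pair circuit on a block: `H` on the partner, then `CNOT` partner → register.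
[cite: NielsenChuang2010, §1.3.6 (Bell states, Fig. 1.12)] -/
def bellCirc : QCircuit cliffordT 2 := ⟨[hOn 1, cnotOn 1 0 (by decide)]⟩

/-- The one-clean-qubit block: the first `1 + k` wires. [folklore] -/
def blk : Fin (1 + k) ↪ Fin (1 + k + k) := Fin.castLEEmb (by omega)

/-- **The purified circuit** of `C` (on the clean wire `0` and the register `1 … k`): a Bell pair
between every register wire and its partner, then `C` on the first `1 + k` wires. Tracing out the
partners leaves the register maximally mixed, so `C` sees `|0⟩⟨0| ⊗ I/2ᵏ`.
[cite: NielsenChuang2010, §2.5 (purifications) and §1.3.6] -/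
def purified (C : QCircuit cliffordT (1 + k)) : QCircuit cliffordT (1 + k + k) :=
  ⟨((List.finRange k).flatMap fun i => (mapWires (bellE k i) bellCirc).gates) ++ (mapWires (blk k) C).gates⟩

/-- The raw gates of the Bell layer. [folklore] -/
def purifyRaws : List RawGate :=
  (List.range k).flatMap fun i => [((false, 0, [1 + k + i]) : RawGate), (false, 3, [1 + k + i, 1 + i])]

variable {k}

/-- **The raw description of the purified circuit.** [folklore] -/
theorem rawGates_purified (C : QCircuit cliffordT (1 + k)) :
    (purified k C).rawGates = purifyRaws k ++ C.rawGates := by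
  rw [purified, QCircuit.rawGates, List.map_append]
  congr 1
  · rw [List.map_flatMap, purifyRaws, ← flatMap_finRange_eq]
    rfl
  · exact rawGates_mapWires_castLE _ C

/-- The purified circuit of an oracle-free circuit is oracle-free. [folklore] -/
theorem purified_isOracleFree {C : QCircuit cliffordT (1 + k)} (hC : C.IsOracleFree) : (purified k C).IsOracleFree := by
  intro g hg
  simp only [purified, List.mem_append, List.mem_flatMap, List.mem_finRange, true_and] at hg
  rcases hg with ⟨i, hg⟩ | hg
  · refine isOracleFree_mapWires (bellE k i) (C := bellCirc) ?_ g hg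
    intro g' hg'
    simp only [bellCirc, List.mem_cons, List.not_mem_nil, or_false] at hg'
    rcases hg' with rfl | rfl <;> trivial
  · exact isOracleFree_mapWires (blk k) hC g hg

/-- The size of the purified circuit. [folklore] -/
theorem length_gates_purified (C : QCircuit cliffordT (1 + k)) : (purified k C).gates.length = 2 * k + C.gates.length := by
  rw [purified, List.length_append, gates_mapWires, List.length_map]
  have : ((List.finRange k).flatMap fun i => (mapWires (bellE k i) bellCirc).gates).length = 2 * k := by
    rw [List.length_flatMap]
    simp [bellCirc, mapWires, List.sum_replicate, Nat.mul_comm]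
  rw [this]

/-- Two-qubit labels are determined by their two bits. [folklore] -/
theorem qReg_two_eq_iff (z w : QReg 2) : z = w ↔ z 0 = w 0 ∧ z 1 = w 1 :=
  ⟨fun h => by subst h; exact ⟨rfl, rfl⟩, fun h => funext fun i => by fin_cases i <;> [exact h.1; exact h.2]⟩

/-- The Bell state: `(|00⟩ + |11⟩)/√2` as produced by `bellCirc` on `|00⟩`.
[cite: NielsenChuang2010, §1.3.6 eq. (1.27)] -/
theorem bellCirc_mulVec_zero (z : QReg 2) :
    (bellCirc.toMatrix 0 *ᵥ basisState (fun _ => false)) z = if z 0 = z 1 then invSqrt2 else 0 := by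
  have h1 : (hOn (1 : Fin 2)).toMatrix 0 *ᵥ basisState (fun _ : Fin 2 => false) =
      invSqrt2 • (basisState (fun _ => false) + basisState (Function.update (fun _ => false) 1 true)) :=
    hOn_mulVec_basisState 1 _ rfl
  rw [bellCirc, QCircuit.toMatrix_cons, QCircuit.toMatrix_cons, QCircuit.toMatrix_nil, Matrix.one_mul, ← Matrix.mulVec_mulVec,
    h1, Matrix.mulVec_smul, Matrix.mulVec_add, cnotOn_mulVec_basisState, cnotOn_mulVec_basisState]
  have e0 : Function.update (fun _ : Fin 2 => false) 0 ((fun _ : Fin 2 => false) 0 ^^ (fun _ : Fin 2 => false) 1) =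
      fun _ => false := by
    funext i; fin_cases i <;> rfl
  have e1 : Function.update (Function.update (fun _ : Fin 2 => false) 1 true) 0
      (Function.update (fun _ : Fin 2 => false) 1 true 0 ^^ Function.update (fun _ : Fin 2 => false) 1 true 1) =
      fun _ => true := by
    funext i; fin_cases i <;> rfl
  rw [e0, e1]
  simp only [Pi.smul_apply, Pi.add_apply, basisState_apply, smul_eq_mul, qReg_two_eq_iff]
  rcases Bool.eq_false_or_eq_true (z 0) with h0 | h0 <;> rcases Bool.eq_false_or_eq_true (z 1) with h1 | h1 <;> simp [h0, h1]

/-- Every wire is the clean wire `0`, a register wire or a partner wire. [folklore] -/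
theorem wire_cases (w : Fin (1 + k + k)) : w = ⟨0, by omega⟩ ∨ (∃ i, w = qW k i) ∨ (∃ i, w = pW k i) := by
  by_cases h0 : (w : ℕ) = 0
  · exact Or.inl (Fin.ext h0)
  · by_cases h1 : (w : ℕ) < 1 + k
    · exact Or.inr (Or.inl ⟨⟨w - 1, by omega⟩, Fin.ext (by simp; omega)⟩)
    · exact Or.inr (Or.inr ⟨⟨w - 1 - k, by omega⟩, Fin.ext (by simp; omega)⟩)

/-- The Bell blocks are pairwise disjoint. [folklore] -/
theorem blockDisjoint_bellE : BlockDisjoint (bellE k) := by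
  intro i j hij
  rw [bellE, bellE, range_pairEmb, range_pairEmb, Set.disjoint_iff]
  rintro w ⟨hw, hw'⟩
  simp only [Set.mem_insert_iff, Set.mem_singleton_iff] at hw hw'
  apply hij
  ext
  rcases hw with rfl | rfl <;> rcases hw' with h | h <;> have := congrArg Fin.val h <;> simp at this <;> omega

/-- Off the Bell blocks there is only the clean wire. [folklore] -/
theorem offBlocks_bellE_iff (w : Fin (1 + k + k)) : OffBlocks (bellE k) w ↔ w = ⟨0, by omega⟩ := by
  constructor
  · intro h
    rcases wire_cases w with hw | ⟨i, rfl⟩ | ⟨i, rfl⟩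
    · exact hw
    · exact absurd ⟨0, rfl⟩ (h i)
    · exact absurd ⟨1, rfl⟩ (h i)
  · rintro rfl i ⟨p, hp⟩
    have := congrArg Fin.val hp
    fin_cases p <;> simp [bellE] at this

/-- The label with clean wire `0` and both the register and the partners carrying `r`. [folklore] -/
def lab (r : QReg k) : QReg (1 + k + k) := fun w =>
  if h0 : (w : ℕ) = 0 then false else if h : (w : ℕ) < 1 + k then r ⟨w - 1, by omega⟩ else r ⟨w - 1 - k, by omega⟩

/-- `lab r` on the clean wire. [folklore] -/
theorem lab_zero (r : QReg k) (h : 0 < 1 + k + k) : lab r ⟨0, h⟩ = false := by simp [lab]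

/-- `lab r` on a register wire. [folklore] -/
theorem lab_qW (r : QReg k) (i : Fin k) : lab r (qW k i) = r i := by
  unfold lab
  rw [dif_neg (show ¬((qW k i : ℕ) = 0) by simp), dif_pos (show (qW k i : ℕ) < 1 + k by simp)]
  congr 1; ext; simp

/-- `lab r` on a partner wire. [folklore] -/
theorem lab_pW (r : QReg k) (i : Fin k) : lab r (pW k i) = r i := by
  unfold lab
  rw [dif_neg (show ¬((pW k i : ℕ) = 0) by simp), dif_neg (show ¬((pW k i : ℕ) < 1 + k) by simp)]
  congr 1; ext; simp only [val_pW]; omega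

/-- Characterisation of `lab r`. [folklore] -/
theorem eq_lab_iff (z : QReg (1 + k + k)) (r : QReg k) (h : 0 < 1 + k + k) :
    z = lab r ↔ z ⟨0, h⟩ = false ∧ (∀ i, z (qW k i) = r i) ∧ ∀ i, z (pW k i) = r i := by
  constructor
  · rintro rfl; exact ⟨lab_zero r h, fun i => lab_qW r i, fun i => lab_pW r i⟩
  · rintro ⟨h0, hq, hp⟩
    funext w
    rcases wire_cases w with rfl | ⟨i, rfl⟩ | ⟨i, rfl⟩
    · rw [h0, lab_zero]
    · rw [hq, lab_qW]
    · rw [hp, lab_pW]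

/-- **The Bell layer prepares `2^{-k/2} ∑_r |0, r, r⟩`.** [cite: NielsenChuang2010, §2.5 (purification of the maximally mixed state)] -/
theorem bellLayer_mulVec_zero :
    (⟨(List.finRange k).flatMap fun i => (mapWires (bellE k i) bellCirc).gates⟩ : QCircuit cliffordT (1 + k + k)).toMatrix 0 *ᵥ
        basisState (fun _ => false) =
      invSqrt2 ^ k • ∑ r : QReg k, basisState (lab r) := by
  have hk : 0 < 1 + k + k := by omega
  rw [basisState_eq_prodState (bellE k) (fun _ => false),
    toMatrix_flatMap_mapWires_mulVec_prodState 0 blockDisjoint_bellE (fun _ => bellCirc)]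
  funext z
  -- the right-hand side counts the (at most one) `r` with `z = lab r`
  have hcount : (∑ r : QReg k, basisState (lab r) z) =
      if z ⟨0, hk⟩ = false ∧ ∀ i, z (qW k i) = z (pW k i) then 1 else 0 := by
    simp only [basisState_apply]
    by_cases h : z ⟨0, hk⟩ = false ∧ ∀ i, z (qW k i) = z (pW k i)
    · rw [if_pos h, Finset.sum_eq_single (fun i => z (pW k i))]
      · rw [if_pos ((eq_lab_iff z _ hk).2 ⟨h.1, fun i => h.2 i, fun i => rfl⟩)]
      · intro r _ hr
        rw [if_neg]
        intro hz
        exact hr (funext fun i => (((eq_lab_iff z r hk).1 hz).2.2 i).symm)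
      · exact fun h' => absurd (Finset.mem_univ _) h'
    · rw [if_neg h]
      refine Finset.sum_eq_zero fun r _ => if_neg fun hz => h ?_
      obtain ⟨h0, hq, hp⟩ := (eq_lab_iff z r hk).1 hz
      exact ⟨h0, fun i => (hq i).trans (hp i).symm⟩
  -- the left-hand side is the product of the Bell amplitudes
  have hf : ∀ i : Fin k, (bellCirc.toMatrix 0 *ᵥ basisState ((fun _ : Fin (1 + k + k) => false) ∘ bellE k i)) (z ∘ bellE k i) =
      if z (qW k i) = z (pW k i) then invSqrt2 else 0 := fun i => bellCirc_mulVec_zero _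
  have hprod : (∏ i : Fin k, (bellCirc.toMatrix 0 *ᵥ basisState ((fun _ : Fin (1 + k + k) => false) ∘ bellE k i)) (z ∘ bellE k i)) =
      if ∀ i, z (qW k i) = z (pW k i) then invSqrt2 ^ k else 0 := by
    rw [Finset.prod_congr rfl (fun i _ => hf i)]
    by_cases h : ∀ i, z (qW k i) = z (pW k i)
    · rw [if_pos h, Finset.prod_congr rfl (fun i _ => if_pos (h i)), Finset.prod_const, Finset.card_univ, Fintype.card_fin]
    · rw [if_neg h]
      obtain ⟨i, hi⟩ := not_forall.1 h
      exact Finset.prod_eq_zero (Finset.mem_univ i) (if_neg hi)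
  have hoff : (∀ w, OffBlocks (bellE k) w → z w = (fun _ : Fin (1 + k + k) => false) w) ↔ z ⟨0, hk⟩ = false :=
    ⟨fun h => h _ ((offBlocks_bellE_iff _).2 rfl), fun h w hw => by rw [(offBlocks_bellE_iff w).1 hw]; exact h⟩
  rw [prodState_apply, hprod, Pi.smul_apply, Finset.sum_apply, hcount, smul_eq_mul]
  by_cases h0 : z ⟨0, hk⟩ = false
  · rw [if_pos (hoff.2 h0)]
    by_cases h : ∀ i, z (qW k i) = z (pW k i)
    · rw [if_pos h, if_pos ⟨h0, h⟩, one_mul, mul_one]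
    · rw [if_neg h, if_neg (fun h' : _ ∧ _ => h h'.2), mul_zero, mul_zero]
  · rw [if_neg (mt hoff.1 h0), zero_mul, if_neg (fun h' : _ ∧ _ => h0 h'.1), mul_zero]

/-- `lab r` restricted to the one-clean-qubit block is `|0⟩|r⟩`. [folklore] -/
theorem lab_comp_blk (r : QReg k) : lab r ∘ blk k = Fin.append (fun _ : Fin 1 => false) r := by
  funext j
  simp only [Function.comp_apply]
  by_cases hj : (j : ℕ) = 0
  · have h1 : blk k j = ⟨0, by omega⟩ := Fin.ext (by simp [blk, hj])
    have h2 : Fin.castAdd k (0 : Fin 1) = j := Fin.ext (by simp [hj])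
    have h3 := Fin.append_left (fun _ : Fin 1 => false) r 0
    rw [h2] at h3
    rw [h1, lab_zero, h3]
  · have h1 : blk k j = qW k ⟨j - 1, by omega⟩ := Fin.ext (by simp [blk]; omega)
    have h2 : Fin.natAdd 1 ⟨j - 1, by omega⟩ = j := Fin.ext (by simp; omega)
    have h3 := Fin.append_right (fun _ : Fin 1 => false) r ⟨j - 1, by omega⟩
    rw [h2] at h3
    rw [h1, lab_qW, h3]

/-- Agreement with `lab r` off the block singles out `r`. [folklore] -/
theorem agreeOff_lab_iff (x : QReg (1 + k + k)) (r : QReg k) : AgreeOff (blk k) x (lab r) ↔ r = fun i => x (pW k i) := by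
  have hrange : ∀ w : Fin (1 + k + k), w ∉ Set.range (blk k) ↔ 1 + k ≤ (w : ℕ) := fun w => not_mem_range_castLEEmb_iff _ w
  constructor
  · intro h
    funext i
    have := h (pW k i) ((hrange _).2 (by simp))
    rw [lab_pW] at this
    exact this.symm
  · rintro rfl w hw
    rcases wire_cases w with rfl | ⟨i, rfl⟩ | ⟨i, rfl⟩
    · exact absurd ((hrange _).1 hw) (by simp)
    · exact absurd ((hrange _).1 hw) (by simp)
    · rw [lab_pW]

/-- **The one clean qubit by purification.** The purified circuit, run on `|0…0⟩`, yields `1` on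
wire `0` with probability the AVERAGE over the register contents `r ∈ {0,1}ᵏ` of the probability that
`C`, run on `|0⟩|r⟩`, yields `1` on wire `0` — i.e. `C` applied to `|0⟩⟨0| ⊗ I/2ᵏ` (Knill–Laflamme's
DQC1 input: "one bit in a pure state and the rest completely random").
[cite: KnillLaflamme1998, p. 5673 (DQC1)] [cite: NielsenChuang2010, §2.5 (purifications)] -/
theorem probEvent_purified (C : QCircuit cliffordT (1 + k)) :
    (purified k C).probEvent 0 (basisState fun _ => false) (QCircuit.acceptEvent (1 + k + k)) =
      ∑ r : QReg k, ((1 : ℝ) / 2 ^ k) *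
        C.probEvent 0 (basisState (Fin.append (fun _ : Fin 1 => false) r)) (QCircuit.acceptEvent (1 + k)) := by
  classical
  set U := C.toMatrix 0 with hU
  set φ : QReg k → QReg (1 + k) → ℂ := fun r => U *ᵥ basisState (Fin.append (fun _ : Fin 1 => false) r) with hφ
  -- the output state
  have hrun : (purified k C).runOn 0 (basisState fun _ => false) =
      invSqrt2 ^ k • ∑ r : QReg k, restBlockState (blk k) (φ r) (lab r) := by
    rw [QCircuit.runOn, purified, show (⟨((List.finRange k).flatMap fun i => (mapWires (bellE k i) bellCirc).gates) ++
        (mapWires (blk k) C).gates⟩ : QCircuit cliffordT (1 + k + k)) =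
        (⟨(List.finRange k).flatMap fun i => (mapWires (bellE k i) bellCirc).gates⟩ : QCircuit cliffordT _).append
          (mapWires (blk k) C) from rfl,
      QCircuit.toMatrix_append, ← Matrix.mulVec_mulVec, bellLayer_mulVec_zero, Matrix.mulVec_smul, Matrix.mulVec_sum,
      toMatrix_mapWires]
    congr 1
    refine Finset.sum_congr rfl fun r _ => ?_
    rw [basisState_eq_restBlockState (blk k) (lab r), lab_comp_blk, placeGate_mulVec_restBlockState]
  -- events
  have hk : 0 < 1 + k + k := by omega
  have hev : ∀ y : QReg (1 + k + k), y ∈ QCircuit.acceptEvent (1 + k + k) ↔ y ⟨0, hk⟩ = true := fun y =>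
    ⟨fun ⟨_, h⟩ => h, fun h => ⟨hk, h⟩⟩
  have hev' : ∀ f : QReg (1 + k), f ∈ QCircuit.acceptEvent (1 + k) ↔ f ⟨0, by omega⟩ = true := fun f =>
    ⟨fun ⟨_, h⟩ => h, fun h => ⟨by omega, h⟩⟩
  -- pointwise, only `r = partners of x` contributes
  have hpt : ∀ x : QReg (1 + k + k), (∑ r : QReg k, restBlockState (blk k) (φ r) (lab r) x) =
      φ (fun i => x (pW k i)) (x ∘ blk k) := by
    intro x
    simp only [restBlockState_apply, agreeOff_lab_iff]
    rw [Finset.sum_ite_eq' Finset.univ (fun i => x (pW k i)) (fun r => φ r (x ∘ blk k))]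
    simp
  have hsq : ∀ x : QReg (1 + k + k), ‖(invSqrt2 ^ k • ∑ r : QReg k, restBlockState (blk k) (φ r) (lab r)) x‖ ^ 2 =
      ∑ r : QReg k, if AgreeOff (blk k) x (lab r) then (1 / 2 : ℝ) ^ k * ‖φ r (x ∘ blk k)‖ ^ 2 else 0 := by
    intro x
    simp only [agreeOff_lab_iff]
    rw [Finset.sum_ite_eq' Finset.univ (fun i => x (pW k i)) (fun r => (1 / 2 : ℝ) ^ k * ‖φ r (x ∘ blk k)‖ ^ 2), if_pos (Finset.mem_univ _),
      Pi.smul_apply, Finset.sum_apply, hpt, smul_eq_mul, norm_mul, mul_pow, norm_invSqrt2_pow_sq]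
  rw [QCircuit.probEvent, Finset.sum_filter, hrun]
  simp_rw [hev, hsq]
  rw [show (∑ x : QReg (1 + k + k), if x ⟨0, hk⟩ = true then ∑ r : QReg k,
      (if AgreeOff (blk k) x (lab r) then (1 / 2 : ℝ) ^ k * ‖φ r (x ∘ blk k)‖ ^ 2 else 0) else 0) =
      ∑ x : QReg (1 + k + k), ∑ r : QReg k, if AgreeOff (blk k) x (lab r) then
        (if (x ∘ blk k) ⟨0, by omega⟩ = true then (1 / 2 : ℝ) ^ k * ‖φ r (x ∘ blk k)‖ ^ 2 else 0) else 0 from ?_,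
    Finset.sum_comm]
  · refine Finset.sum_congr rfl fun r _ => ?_
    rw [sum_ite_agreeOff_eq_sum_extend, QCircuit.probEvent, Finset.sum_filter, Finset.mul_sum, _root_.one_div_pow]
    refine Finset.sum_congr rfl fun f _ => ?_
    rw [extend_comp_embedding, hev' f, QCircuit.runOn, ← hU]
    split_ifs <;> simp [hφ]
  · refine Finset.sum_congr rfl fun x _ => ?_
    have h0 : (x ∘ blk k) ⟨0, by omega⟩ = x ⟨0, hk⟩ := rfl
    rw [h0]
    by_cases hx : x ⟨0, hk⟩ = true
    · simp only [hx, if_true]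
    · simp only [hx]
      simp
end Purify

/-! ### The DQC1 front end: purify, transport, tabulate -/

section DQC1Front

open Complexity.CodeFP

/-- **The executor input of a one-clean-qubit circuit** given by its register size `k` and raw gate
list `raws` (a circuit on the wires `0, …, k`): the gate table of length `t⁴`, `t = 3 + 2k + |raws|`,
of the purified circuit (Bell layer on the register/partner wires `1 … 2k`, then the circuit).
[cite: KnillLaflamme1998, p. 5673 (DQC1: "one bit in a pure state and the rest completely random")] -/
def dqcTableRaw (k : ℕ) (raws : List RawGate) : List Bool :=
  tableOfL ((3 + 2 * k + raws.length) ^ 4) (purifyRaws k ++ raws)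

/-- **The executor on the DQC1 table computes the DQC1 acceptance probability**: the average over the
register contents `r` of the probability that `C`, run on `|0⟩|r⟩`, yields `1` on wire `0`.
[cite: KnillLaflamme1998, p. 5673 (DQC1)] [cite: NielsenChuang2010, §2.5, §4.5] -/
theorem acceptProbOn_family_dqcTableRaw {k : ℕ} (C : QCircuit cliffordT (1 + k)) (hC : C.IsOracleFree) :
    family.acceptProbOn 0 (dqcTableRaw k C.rawGates) =
      ∑ r : QReg k, ((1 : ℝ) / 2 ^ k) *
        C.probEvent 0 (basisState (Fin.append (fun _ : Fin 1 => false) r)) (QCircuit.acceptEvent (1 + k)) := by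
  set t := 3 + 2 * k + C.rawGates.length with ht
  have htO : tOf (t ^ 4) = t := tOf_pow_four t
  have hF : Fits (t ^ 4) := by unfold Fits; rw [htO]; exact one_add_mul_rowW_le_pow_four (by omega)
  have ht0 : 0 < tOf (t ^ 4) := by rw [htO]; omega
  have hle : 1 + k + k ≤ tOf (t ^ 4) := by rw [htO]; omega
  set gs : List (QGate cliffordT (tOf (t ^ 4))) := (mapWires (Fin.castLEEmb hle) (purified k C)).gates with hgs
  have hraw : gs.map QGate.toRaw = purifyRaws k ++ C.rawGates := by
    rw [hgs, ← QCircuit.rawGates, rawGates_mapWires_castLE, rawGates_purified]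
  have hlen : gs.length ≤ tOf (t ^ 4) := by
    rw [hgs, gates_mapWires, List.length_map, length_gates_purified, htO, ht, QCircuit.length_rawGates, QCircuit.size]
    omega
  have hfree : ∀ γ ∈ gs, γ.IsOracleFree := isOracleFree_mapWires _ (purified_isOracleFree hC)
  rw [dqcTableRaw, ← hraw, acceptProbOn_family_tableOfL hF ht0 gs hlen hfree,
    show (⟨gs⟩ : QCircuit cliffordT (tOf (t ^ 4))) = mapWires (Fin.castLEEmb hle) (purified k C) from rfl,
    probEvent_mapWires_castLE hle (by omega), probEvent_purified]

/-- Squaring a unary numeral on codes: `1ⁿ ↦ 1^{n²}` (the total length of `n` blocks of `n` units).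
[cite: AroraBarak2009, §1.3 (bounded loops)] -/
theorem unSq : CodeFP unE unE (fun n => n * n) := by
  have hcopies : CodeFP unE (rawE (rawE unitE)) (fun n => (List.replicate n ()).map fun _ => List.replicate n ()) :=
    ((map (σ := ℕ) (α := Unit) (eσ := unE) (eα := unitE) (g := fun t => List.replicate t.1 ()) (replicateUnit.comp (fst _ _))).comp
      ((CodeFP.id unE).pair replicateUnit)).congr fun _ => rfl
  exact ((ulength unitE).comp ((flatten unitE).comp hcopies)).congr fun n => by simp [List.map_replicate]

/-- The raw Bell layer on codes (context: `k` in unary). [folklore] -/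
theorem purifyRaws_fp : CodeFP unE (rawE RawGate.E) purifyRaws := by
  have hK : CodeFP (pairE unE natE) natE (fun c => c.1) := natOfUn.comp (fst _ _)
  have hI : CodeFP (pairE unE natE) natE (fun c => c.2) := snd _ _
  have hp : CodeFP (pairE unE natE) natE (fun c => 1 + c.1 + c.2) := (natAdd.comp ((natAdd.comp ((const _ 1).pair hK)).pair hI) :)
  have hq : CodeFP (pairE unE natE) natE (fun c => 1 + c.2) := (natAdd.comp ((const _ 1).pair hI) :)
  have hg1 : CodeFP (pairE unE natE) RawGate.E (fun c => ((false, 0, [1 + c.1 + c.2]) : RawGate)) := rawGate_of (const _ 0) (natListE1 hp)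
  have hg2 : CodeFP (pairE unE natE) RawGate.E (fun c => ((false, 3, [1 + c.1 + c.2, 1 + c.2]) : RawGate)) :=
    rawGate_of (const _ 3) (natListE2 hp hq)
  have hF : CodeFP (pairE unE natE) (rawE RawGate.E) (fun c => [((false, 0, [1 + c.1 + c.2]) : RawGate), (false, 3, [1 + c.1 + c.2, 1 + c.2])]) :=
    ((rawCons _).comp (hg1.pair ((rawSingleton _).comp hg2)) :)
  exact (flatMapRange (eσ := unE) (F := fun (c i : ℕ) => [((false, 0, [1 + c + i]) : RawGate), (false, 3, [1 + c + i, 1 + i])])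
    (CodeFP.id unE) hF).congr fun c => by rw [purifyRaws]; rfl

/-- **The DQC1 table on codes**: `(1ᵏ, raws) ↦ dqcTableRaw k raws` is computed in polynomial time.
[cite: AroraBarak2009, §1.3, §6.2] -/
theorem dqcTableRaw_fp : CodeFP tcE strE (fun c => dqcTableRaw c.1 c.2) := by
  have hk : CodeFP tcE unE (fun c => c.1) := fst _ _
  have hraws : CodeFP tcE (rawE RawGate.E) (fun c => c.2) := snd _ _
  have ht0 : CodeFP tcE unE (fun c => 3 + (c.1 + c.1) + c.2.length) :=
    (unAdd.comp ((unAdd.comp ((const _ 3).pair (unAdd.comp (hk.pair hk)))).pair ((ulength _).comp hraws)) :)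
  have ht : CodeFP tcE unE (fun c => 3 + 2 * c.1 + c.2.length) := ht0.congr fun c => by ring
  have hℓ0 : CodeFP tcE unE (fun c => ((3 + 2 * c.1 + c.2.length) * (3 + 2 * c.1 + c.2.length)) *
      ((3 + 2 * c.1 + c.2.length) * (3 + 2 * c.1 + c.2.length))) :=
    (unSq.comp (unSq.comp ht) :)
  have hℓ : CodeFP tcE unE (fun c => (3 + 2 * c.1 + c.2.length) ^ 4) := hℓ0.congr fun c => by ring
  have hlist : CodeFP tcE (rawE RawGate.E) (fun c => purifyRaws c.1 ++ c.2) := ((rawAppend _).comp ((purifyRaws_fp.comp hk).pair hraws) :)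
  exact ((tableOfL_fp.comp (hℓ.pair hlist)).congr fun c => rfl :)

end DQC1Front

end UExec

end Literature.Computability.QuantumComplexity

end
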